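import Literature.Analysis.OperatorTheory.SimilarityHeatSemigroupFourier
import Mathlib.Analysis.InnerProductSpace.LinearMap
import Mathlib.MeasureTheory.Function.SpecialFunctions.Inner
import Mathlib.MeasureTheory.Function.L2Space
import HarnessLib

/-!
# The Leray projection as an `L²` Fourier multiplier (symbol `1 − k⊗k/|k|²`)

Analysis/OperatorTheory support file (two definitions with bodies, everything proved, no named
facts). The Helmholtz–Leray projection `ℙ` onto divergence-free fields is, on the Fourier side,
multiplication by the symbol `P(k) = 1 − k⊗k/|k|²` — pointwise the orthogonal projection of the
value `û(k)` onto `k^⊥` (Constantin–Foias, *Navier–Stokes Equations*, Ch. 1; Majda–Bertozzi,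
§1.8 / (3.10); Albritton–Brué–Colombo 2022, §2.2 "`ℙ` is the Leray projector"). Here:

* `lerayAt kc : F →L[ℂ] F` (**definition**), `kc ∈ F` a vector of a complex Hilbert space:
  `v ↦ v − (⟪kc, v⟫/‖kc‖²) kc` (`= 1` for `kc = 0`); `lerayAt_apply`, `inner_lerayAt`
  (`⟪kc, P v⟫ = 0`), `lerayAt_apply_of_inner_eq_zero` (`P v = v` on `kc^⊥`), `lerayAt_idem`
  (`P (P v) = P v`), `norm_lerayAt_apply_le` (`‖P v‖ ≤ ‖v‖`, Pythagoras), `lerayAt_smul`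
  (`P_{a kc} = P_{kc}`, `a ≠ 0`: degree-0 homogeneity of the symbol);
* `fourierLeray ι : Lp F 2 →L[ℂ] Lp F 2` (**definition**), for a continuous real-linear
  `ι : V → F` (the complexification `k ↦ k_ℂ`): the multiplier `(ℙ̂ h)(k) = P(ι k) h(k)`, with
  `fourierLeray_coeFn`, `norm_fourierLeray_apply_le` (`‖ℙ̂ h‖ ≤ ‖h‖`), `fourierLeray_idem`
  (`ℙ̂² = ℙ̂`), and `fourierLeray_comm_fourierSimilarityHeat`: **`ℙ̂` commutes with the
  Fourier-side similarity heat semigroup** `M_τ` (the weight is scalar and `P(e^{−τ/2}k) = P(k)`),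
  so `M_τ` restricts to the divergence-free subspace `ker(1 − ℙ̂)` (`L²_σ` on the Fourier side).

## References

* P. Constantin, C. Foias, *Navier–Stokes Equations*, Univ. Chicago Press 1988, Ch. 1 (the
  Leray projector as the Fourier multiplier `δ_{ij} − k_ik_j/|k|²`). [folklore]
* A. Majda, A. Bertozzi, *Vorticity and Incompressible Flow* (2002), §1.8, (1.73)–(1.75).
  [MajdaBertozziCUP2002]
* D. Albritton, E. Brué, M. Colombo, Ann. of Math. 196 (2022), §2.2. [AlbrittonBrueColombo2022AnnMath]
-/

noncomputable section

open MeasureTheory Filter Topology ComplexInnerProductSpace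
open scoped ENNReal NNReal InnerProductSpace

namespace Literature.Analysis.OperatorTheory

/-! ### The symbol at one frequency: orthogonal projection onto `kc^⊥` -/

section Symbol

variable {F : Type*} [NormedAddCommGroup F] [InnerProductSpace ℂ F]

/-- **The Leray symbol at the frequency vector `kc`**: `v ↦ v − (⟪kc, v⟫/‖kc‖²) kc`, the
orthogonal projection onto `kc^⊥` (the identity when `kc = 0`). [cite: MajdaBertozziCUP2002, §1.8 (1.75)] -/
def lerayAt (kc : F) : F →L[ℂ] F :=
  1 - ((‖kc‖ ^ 2)⁻¹ : ℂ) • (innerSL ℂ kc).smulRight kc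

/-- `lerayAt kc v = v − (⟪kc, v⟫/‖kc‖²) kc`. [cite: MajdaBertozziCUP2002, §1.8 (1.75)] -/
theorem lerayAt_apply (kc v : F) :
    lerayAt kc v = v - ((‖kc‖ ^ 2)⁻¹ : ℂ) • (⟪kc, v⟫ • kc) := by
  simp [lerayAt, ContinuousLinearMap.smulRight_apply, innerSL_apply_apply]

/-- `lerayAt 0 = 1`. [folklore] -/
theorem lerayAt_zero : lerayAt (0 : F) = 1 := by
  ext v; simp [lerayAt_apply]

/-- **`⟪kc, P v⟫ = 0`**: the value is projected onto `kc^⊥` ("`k · ℙ̂u(k) = 0`").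
[cite: MajdaBertozziCUP2002, §1.8 (1.74)] -/
theorem inner_lerayAt (kc v : F) : ⟪kc, lerayAt kc v⟫ = 0 := by
  rw [lerayAt_apply, inner_sub_right, inner_smul_right, inner_smul_right, inner_self_eq_norm_sq_to_K]
  by_cases hk : kc = 0
  · simp [hk]
  · have hn : (‖kc‖ : ℂ) ≠ 0 := by exact_mod_cast (norm_ne_zero_iff.2 hk)
    field_simp
    simp

/-- **`P v = v` when `⟪kc, v⟫ = 0`** (divergence-free values are fixed). [cite: MajdaBertozziCUP2002, §1.8] -/
theorem lerayAt_apply_of_inner_eq_zero {kc v : F} (h : ⟪kc, v⟫ = 0) : lerayAt kc v = v := by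
  rw [lerayAt_apply, h, zero_smul, smul_zero, sub_zero]

/-- **Idempotence `P (P v) = P v`.** [cite: MajdaBertozziCUP2002, §1.8] -/
theorem lerayAt_idem (kc v : F) : lerayAt kc (lerayAt kc v) = lerayAt kc v :=
  lerayAt_apply_of_inner_eq_zero (inner_lerayAt kc v)

/-- `lerayAt kc * lerayAt kc = lerayAt kc`. [folklore] -/
theorem lerayAt_mul_self (kc : F) : lerayAt kc * lerayAt kc = lerayAt kc := by
  ext v; rw [mul_apply_eq_comp, lerayAt_idem]

/-- **`‖P v‖ ≤ ‖v‖`** (Pythagoras: `v = P v + (v − P v)` with `P v ⊥ kc ∥ v − P v`).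
[cite: MajdaBertozziCUP2002, §1.8] -/
theorem norm_lerayAt_apply_le (kc v : F) : ‖lerayAt kc v‖ ≤ ‖v‖ := by
  -- `v − P v` is a multiple of `kc`, hence orthogonal to `P v`
  have horth : ⟪lerayAt kc v, v - lerayAt kc v⟫ = 0 := by
    have h1 : v - lerayAt kc v = ((‖kc‖ ^ 2)⁻¹ : ℂ) • (⟪kc, v⟫ • kc) := by
      rw [lerayAt_apply]; abel
    rw [h1, inner_smul_right, inner_smul_right, ← inner_conj_symm (lerayAt kc v) kc, inner_lerayAt,
      map_zero, mul_zero, mul_zero]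
  have h := norm_add_sq_eq_norm_sq_add_norm_sq_of_inner_eq_zero (lerayAt kc v) (v - lerayAt kc v)
    horth
  rw [add_sub_cancel] at h
  exact (mul_self_le_mul_self_iff (norm_nonneg _) (norm_nonneg _)).2
    (by nlinarith [h, mul_self_nonneg ‖v - lerayAt kc v‖])

/-- `‖lerayAt kc‖ ≤ 1`. [folklore] -/
theorem norm_lerayAt_le (kc : F) : ‖lerayAt kc‖ ≤ 1 :=
  ContinuousLinearMap.opNorm_le_bound _ zero_le_one fun v => by
    rw [one_mul]; exact norm_lerayAt_apply_le kc v

/-- **Degree-0 homogeneity**: `lerayAt (a • kc) = lerayAt kc` for `a ≠ 0` (`a ∈ ℂ`).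
[cite: MajdaBertozziCUP2002, §1.8] -/
theorem lerayAt_smul {a : ℂ} (ha : a ≠ 0) (kc : F) : lerayAt (a • kc) = lerayAt kc := by
  ext v
  rw [lerayAt_apply, lerayAt_apply, inner_smul_left, norm_smul, smul_smul, smul_smul, smul_smul]
  by_cases hk : kc = 0
  · simp [hk]
  · congr 2
    have hn : ((‖kc‖ : ℂ)) ≠ 0 := by exact_mod_cast (norm_ne_zero_iff.2 hk)
    have ha' : ((‖a‖ : ℂ)) ≠ 0 := by exact_mod_cast (norm_ne_zero_iff.2 ha)
    have hconj : (starRingEnd ℂ) a * a = (‖a‖ : ℂ) ^ 2 := by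
      rw [Complex.conj_mul']
    push_cast
    field_simp
    rw [← hconj]
    ring

/-- Real scalars: `lerayAt ((a : ℂ) • kc) = lerayAt kc` for `a ≠ 0`. [folklore] -/
theorem lerayAt_real_smul {a : ℝ} (ha : a ≠ 0) (kc : F) : lerayAt ((a : ℂ) • kc) = lerayAt kc :=
  lerayAt_smul (by exact_mod_cast ha) kc

end Symbol

/-! ### The multiplier on `L^p(V; F)` -/

section Multiplier

variable {V : Type*} [NormedAddCommGroup V] [InnerProductSpace ℝ V] [FiniteDimensional ℝ V]
  [MeasurableSpace V] [BorelSpace V]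
variable {F : Type*} [NormedAddCommGroup F] [InnerProductSpace ℂ F]
variable {p : ℝ≥0∞} [Fact (1 ≤ p)]

omit [Fact (1 ≤ p)] in
/-- Measurability of the pointwise Leray projection of an `L^p` function (explicit formula
`f − ‖ιk‖⁻²⟪ιk, f⟫ ιk`). [folklore] -/
theorem aestronglyMeasurable_lerayAt_apply (ι : V →L[ℝ] F) (f : Lp F p (volume : Measure V)) :
    AEStronglyMeasurable (fun k => lerayAt (ι k) ((f : V → F) k)) (volume : Measure V) := by
  have h1 : AEStronglyMeasurable (fun k => ⟪ι k, (f : V → F) k⟫) (volume : Measure V) :=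
    AEStronglyMeasurable.inner ι.continuous.aestronglyMeasurable (Lp.memLp f).aestronglyMeasurable
  have hm : Measurable fun k : V => ((‖ι k‖ ^ 2)⁻¹ : ℝ) := (ι.continuous.norm.pow 2).measurable.inv
  have h2 : AEStronglyMeasurable (fun k => (((‖ι k‖ ^ 2)⁻¹ : ℝ) : ℂ)) (volume : Measure V) :=
    (Complex.measurable_ofReal.comp hm).aestronglyMeasurable
  have h3 : AEStronglyMeasurable
      (fun k => (f : V → F) k - (((‖ι k‖ ^ 2)⁻¹ : ℝ) : ℂ) • (⟪ι k, (f : V → F) k⟫ • ι k))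
      (volume : Measure V) :=
    (Lp.memLp f).aestronglyMeasurable.sub (h2.smul (h1.smul ι.continuous.aestronglyMeasurable))
  refine h3.congr (Eventually.of_forall fun k => ?_)
  simp only [lerayAt_apply, Complex.ofReal_inv, Complex.ofReal_pow]

omit [Fact (1 ≤ p)] in
/-- `k ↦ P(ιk) f(k)` is in `L^p` with the same bound. [folklore] -/
theorem memLp_lerayAt_apply (ι : V →L[ℝ] F) (f : Lp F p (volume : Measure V)) :
    MemLp (fun k => lerayAt (ι k) ((f : V → F) k)) p (volume : Measure V) :=
  MemLp.of_le (Lp.memLp f) (aestronglyMeasurable_lerayAt_apply ι f)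
    (Eventually.of_forall fun _ => norm_lerayAt_apply_le _ _)

omit [Fact (1 ≤ p)] in
/-- `‖P(ι·) f‖_p ≤ ‖f‖_p`. [folklore] -/
theorem eLpNorm_lerayAt_apply_le (ι : V →L[ℝ] F) (f : Lp F p (volume : Measure V)) :
    eLpNorm (fun k => lerayAt (ι k) ((f : V → F) k)) p (volume : Measure V) ≤
      eLpNorm (f : V → F) p volume :=
  eLpNorm_mono fun _ => norm_lerayAt_apply_le _ _

/-- **The Leray projection as a Fourier multiplier on `L^p(V; F)`**: `(ℙ̂ f)(k) = P(ιk) f(k)`,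
`ι : V → F` the (real-linear, continuous) complexification of frequencies.
[cite: MajdaBertozziCUP2002, §1.8 (1.75); AlbrittonBrueColombo2022AnnMath §2.2] -/
def fourierLeray (ι : V →L[ℝ] F) : Lp F p (volume : Measure V) →L[ℂ] Lp F p (volume : Measure V) :=
  LinearMap.mkContinuous
    { toFun := fun f => (memLp_lerayAt_apply ι f).toLp _
      map_add' := fun f g => by
        apply Lp.ext
        refine (MemLp.coeFn_toLp _).trans ?_
        refine EventuallyEq.trans ?_ (Lp.coeFn_add _ _).symm
        filter_upwards [Lp.coeFn_add f g, MemLp.coeFn_toLp (memLp_lerayAt_apply ι f),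
          MemLp.coeFn_toLp (memLp_lerayAt_apply ι g)] with k hk hx hy
        simp only [Pi.add_apply, hk, hx, hy, map_add]
      map_smul' := fun c f => by
        apply Lp.ext
        refine (MemLp.coeFn_toLp _).trans ?_
        refine EventuallyEq.trans ?_ (Lp.coeFn_smul _ _).symm
        filter_upwards [Lp.coeFn_smul c f, MemLp.coeFn_toLp (memLp_lerayAt_apply ι f)] with k hk hx
        simp only [Pi.smul_apply, hk, hx, map_smul, RingHom.id_apply] }
    1
    (fun f => by
      simp only [LinearMap.coe_mk, AddHom.coe_mk, Lp.norm_toLp, one_mul]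
      rw [Lp.norm_def]
      exact ENNReal.toReal_mono (Lp.memLp f).eLpNorm_ne_top (eLpNorm_lerayAt_apply_le ι f))

/-- `ℙ̂ f = P(ι·) f` a.e. [cite: MajdaBertozziCUP2002, §1.8 (1.75)] -/
theorem fourierLeray_coeFn (ι : V →L[ℝ] F) (f : Lp F p (volume : Measure V)) :
    (fourierLeray ι f : V → F) =ᵐ[(volume : Measure V)] fun k => lerayAt (ι k) ((f : V → F) k) :=
  MemLp.coeFn_toLp (memLp_lerayAt_apply ι f)

/-- **`‖ℙ̂ f‖ ≤ ‖f‖`.** [cite: MajdaBertozziCUP2002, §1.8] -/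
theorem norm_fourierLeray_apply_le (ι : V →L[ℝ] F) (f : Lp F p (volume : Measure V)) :
    ‖fourierLeray ι f‖ ≤ ‖f‖ := by
  rw [Lp.norm_def, Lp.norm_def, eLpNorm_congr_ae (fourierLeray_coeFn ι f)]
  exact ENNReal.toReal_mono (Lp.memLp f).eLpNorm_ne_top (eLpNorm_lerayAt_apply_le ι f)

/-- **`ℙ̂² = ℙ̂`.** [cite: MajdaBertozziCUP2002, §1.8] -/
theorem fourierLeray_mul_self (ι : V →L[ℝ] F) :
    (fourierLeray ι * fourierLeray ι :
        Lp F p (volume : Measure V) →L[ℂ] Lp F p (volume : Measure V)) = fourierLeray ι := by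
  ext1 f
  apply Lp.ext
  rw [mul_apply_eq_comp]
  refine (fourierLeray_coeFn ι _).trans ?_
  filter_upwards [fourierLeray_coeFn ι f] with k hk
  rw [hk, lerayAt_idem]

/-- The values of `ℙ̂ f` are pointwise orthogonal to the frequency: `⟪ι k, (ℙ̂ f)(k)⟫ = 0` a.e.
("`k · û(k) = 0`", the divergence-free condition on the Fourier side). [cite: MajdaBertozziCUP2002, §1.8 (1.74)] -/
theorem inner_fourierLeray_coeFn (ι : V →L[ℝ] F) (f : Lp F p (volume : Measure V)) :
    ∀ᵐ k ∂(volume : Measure V), ⟪ι k, (fourierLeray ι f : V → F) k⟫ = 0 := by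
  filter_upwards [fourierLeray_coeFn ι f] with k hk
  rw [hk, inner_lerayAt]

/-- **`ℙ̂` commutes with the Fourier-side similarity heat semigroup `M_τ`** (scalar weight;
`P(e^{−τ/2}k) = P(k)` by degree-0 homogeneity): hence `M_τ` leaves the divergence-free subspace
`Ran ℙ̂ = ker(1 − ℙ̂)` invariant. [cite: AlbrittonBrueColombo2022AnnMath, §2.2] -/
theorem fourierLeray_comm_fourierSimilarityHeat (ι : V →L[ℝ] F) (hp : p ≠ ∞)
    (τ : ℝ≥0) :
    (fourierLeray ι * fourierSimilarityHeat hp τ :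
        Lp F p (volume : Measure V) →L[ℂ] Lp F p (volume : Measure V)) =
      fourierSimilarityHeat hp τ * fourierLeray ι := by
  ext1 f
  apply Lp.ext
  rw [mul_apply_eq_comp, mul_apply_eq_comp]
  refine (fourierLeray_coeFn ι _).trans ?_
  refine EventuallyEq.trans ?_ (fourierSimilarityHeat_coeFn hp τ _).symm
  have ha : Real.exp (-(τ : ℝ) / 2) ≠ 0 := (Real.exp_pos _).ne'
  filter_upwards [fourierSimilarityHeat_coeFn hp τ f,
    ae_eq_comp_smul (fourierLeray_coeFn ι f) ha] with k hk hk2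
  have hι : ι (Real.exp (-(τ : ℝ) / 2) • k) = ((Real.exp (-(τ : ℝ) / 2) : ℝ) : ℂ) • ι k := by
    rw [ι.map_smul, RCLike.real_smul_eq_coe_smul (K := ℂ)]
    rfl
  rw [hk, map_smul, hk2, hι, lerayAt_real_smul ha]

end Multiplier

end Literature.Analysis.OperatorTheory
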